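import Literature.NumberTheory.Sieve.BombieriFriedlanderIwaniecTrivialBound
import Literature.NumberTheory.Sieve.DivisorPowerSums
import Literature.NumberTheory.Sieve.MoebiusCoprimeProgressions
import HarnessLib

/-!
# Bombieri–Friedlander–Iwaniec 1986: hypothesis (A₂) for dense convolution pieces

Trunk `AntSieve`, companion to `Literature.NumberTheory.Sieve.BombieriFriedlanderIwaniecDispersion`.
Everything here is PROVED.  In the proof of Theorem 10 of Bombieri–Friedlander–Iwaniec (Acta Math.
156 (1986), §§15, 17) the coefficient sequence `β` of a grouped Heath-Brown piece is a Dirichlet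
convolution of boxed, sieved pieces, and p. 246 asserts: "the resulting coefficients … satisfy the
hypothesis of Theorems 1, 2, 3, 4 and 5*. In this case the hypothesis (A₂) (the most crucial one) is
a consequence of the Siegel-Walfisz theorem."  This file isolates the abstract mechanism:

* `Literature.BFI.SWAbs h Nh A₁ A₂ C` — the ABSOLUTE Siegel–Walfisz property of a piece `h` at scale `Nh`:
  for all `k ≤ (log Nh)^{A₁}`, reduced `l`, `d ≥ 1` and all `y`,
  `|∑_{v≤y, v≡l (k), (v,d)=1} h(v) − φ(k)⁻¹ ∑_{v≤y, (v,dk)=1} h(v)| ≤ C τ(d)² Nh (log Nh)^{−A₂}`.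
  (It is supplied for the pieces `1_{(·,P(z))=1} 1_J` and `μ 1_{(·,P(z))=1} 1_J` by the companion
  files on rough numbers and Möbius sums in progressions.)
* `Literature.NumberTheory.Sieve.BFI.bilinear_sum_filter_eq` — the exact identity behind "(A₂) is stable under convolution":
  `∑_{n ≡ l (k), (n,d)=1} (g ⋆ h)(n) = ∑_{(u,dk)=1} g(u) ∑_{v ≡ l ū (k), (v,d)=1} h(v)`, and its
  coprime analogue; hence `Δ(g ⋆ h) = ∑_{(u,dk)=1} g(u) Δ(h; l ū)` (`disc_conv_eq`).
* `Literature.NumberTheory.Sieve.BFI.siegelWalfiszHyp_of_dense` — MAIN: if `h` has `SWAbs` (all exponents), `|h| ≤ 1`,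
  `Nh < supp h ≤ 2Nh`, `|g| ≤ τ^{c_g}`, `supp g · supp h ⊆ (N, 2N]`, `log 2N ≤ K log Nh`, and `β = g ⋆ h`
  is DENSE (`‖β‖² ≥ N (log 2N)^{−c_D}`), then `β` satisfies BFI's (A₂) in the vendored form
  `Literature.BFI.SiegelWalfiszHyp N 2 Csw β`, with a family of constants `Csw` depending only on the
  structural data `(Shiu's constants, c_g, c_D, K, C_h)` — not on `N`, `g`, `h`.  Small moduli use
  `SWAbs`, middle moduli `(log 2N)^{A₁} < k < N^{3/4}` Shiu's Brun–Titchmarsh theorem for `τ^{c_g+1}`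
  (named fact `Literature.NumberTheory.Sieve.Shiu1980BrunTitchmarsh`) and `1/φ(k) ≤ τ(k)/k ≤ C k^{−1/2}`, large moduli the
  divisor bound; the density hypothesis converts absolute into relative (`‖β‖ N^{1/2}`) bounds.
  Sparse pieces (failing the density hypothesis) are discarded by trivial bounds in the assembly.

## References

* E. Bombieri, J. B. Friedlander, H. Iwaniec, Acta Math. 156 (1986), §1 (A₂) p. 206, §15 p. 246.
  [BombieriFriedlanderIwaniecActa1986]
* P. Shiu, J. reine angew. Math. 313 (1980), Theorem 1. [Shiu1980]
-/

open Finset Real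
open scoped ArithmeticFunction.sigma

namespace Literature.NumberTheory.Sieve

namespace BFI

/-! ### The absolute Siegel–Walfisz property of a piece -/

/-- `SWAbs h Nh A₁ A₂ C`: the piece `h` (at scale `Nh`) is well distributed in reduced classes to
moduli `k ≤ (log Nh)^{A₁}`, uniformly in an auxiliary coprimality condition `(v, d) = 1` and in the
length `y`, with an absolute saving `(log Nh)^{−A₂}`:
`|∑_{v ≤ y, v ≡ l (k), (v,d)=1} h(v) − φ(k)⁻¹ ∑_{v ≤ y, (v,dk)=1} h(v)| ≤ C τ(d)² Nh (log Nh)^{−A₂}`.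
(The absolute form of BFI's (A₂), p. 206, appropriate for a single bounded piece.)
[cite: BombieriFriedlanderIwaniecActa1986, §1 (A₂) p. 206] -/
def SWAbs (h : ℕ → ℝ) (Nh A₁ A₂ C : ℝ) : Prop :=
  ∀ k : ℕ, 1 ≤ k → (k : ℝ) ≤ Real.log Nh ^ A₁ → ∀ l : ZMod k, IsUnit l → ∀ d : ℕ, d ≠ 0 → ∀ y : ℝ,
    |(∑ v ∈ (Icc 1 ⌊y⌋₊).filter (fun v : ℕ => (v : ZMod k) = l ∧ v.Coprime d), h v) -
        (∑ v ∈ (Icc 1 ⌊y⌋₊).filter (fun v : ℕ => v.Coprime (d * k)), h v) / (Nat.totient k : ℝ)| ≤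
      C * (σ 0 d : ℝ) ^ 2 * Nh / Real.log Nh ^ A₂

/-- `SWAbs` is monotone in the constant. [folklore] -/
theorem SWAbs.mono {h : ℕ → ℝ} {Nh A₁ A₂ C C' : ℝ} (hsw : SWAbs h Nh A₁ A₂ C) (hC : C ≤ C')
    (hNh : 1 ≤ Nh) : SWAbs h Nh A₁ A₂ C' := by
  intro k hk hkA l hl d hd y
  refine (hsw k hk hkA l hl d hd y).trans ?_
  have : 0 ≤ Real.log Nh := Real.log_nonneg hNh
  refine div_le_div_of_nonneg_right ?_ (by positivity)
  refine mul_le_mul_of_nonneg_right (mul_le_mul_of_nonneg_right hC (by positivity)) (by linarith)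

/-! ### Sums restricted to supports -/

/-- If `f` vanishes outside both `s` and `t` in the sense that every `v` with `f v ≠ 0` lies in
`s` iff it lies in `t`, then `∑_s f = ∑_t f`. [folklore] -/
theorem sum_eq_sum_of_support {f : ℕ → ℝ} {s t : Finset ℕ}
    (h : ∀ v, f v ≠ 0 → (v ∈ s ↔ v ∈ t)) : ∑ v ∈ s, f v = ∑ v ∈ t, f v := by
  rw [← Finset.sum_filter_ne_zero s, ← Finset.sum_filter_ne_zero t]
  refine Finset.sum_congr ?_ fun _ _ => rfl
  ext v
  simp only [Finset.mem_filter]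
  constructor
  · rintro ⟨hv, hf⟩; exact ⟨(h v hf).1 hv, hf⟩
  · rintro ⟨hv, hf⟩; exact ⟨(h v hf).2 hv, hf⟩

/-- `m ∼ M` as a filter of `[1, ⌊2M⌋]`. [folklore] -/
theorem dyadic_eq_filter_Icc {M : ℝ} (hM : 0 ≤ M) :
    dyadic M = (Icc 1 ⌊2 * M⌋₊).filter (fun m : ℕ => M < m) := by
  ext m
  rw [mem_dyadic hM, Finset.mem_filter, Finset.mem_Icc, Nat.le_floor_iff (by linarith)]
  constructor
  · rintro ⟨h1, h2⟩
    refine ⟨⟨?_, h2⟩, h1⟩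
    have : (0 : ℝ) < m := hM.trans_lt h1
    exact_mod_cast this
  · rintro ⟨⟨-, h2⟩, h1⟩; exact ⟨h1, h2⟩

/-- `dyadic M ⊆ [1, ⌊2M⌋]`. [folklore] -/
theorem dyadic_subset_Icc {M : ℝ} (hM : 0 ≤ M) : dyadic M ⊆ Icc 1 ⌊2 * M⌋₊ := by
  rw [dyadic_eq_filter_Icc hM]; exact Finset.filter_subset _ _

/-! ### The convolution identity -/

/-- **Opening `g ⋆ h` in a progression with a coprimality condition.**  Let `g, h` be arithmetic
functions with `g(u) h(v) ≠ 0 ⇒ N < uv ≤ 2N` and `h(v) ≠ 0 ⇒ v ≤ 2Nh`.  Then for `k ≥ 1`, a reduced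
class `l (mod k)` and `d`:
`∑_{n∼N, n≡l (k), (n,d)=1} (g⋆h)(n) = ∑_{u ≤ 2N, (u,dk)=1} g(u) ∑_{v ≤ 2Nh, uv ≡ l (k), (v,d)=1} h(v)`.
[cite: BombieriFriedlanderIwaniecActa1986, §15 p. 246] -/
theorem bilinear_sum_filter_eq {g h : ArithmeticFunction ℝ} {N Nh : ℝ} (hN : 0 ≤ N)
    (hprod : ∀ u v : ℕ, g u ≠ 0 → h v ≠ 0 → u * v ∈ dyadic N)
    (hhsupp : ∀ v : ℕ, h v ≠ 0 → (v : ℝ) ≤ 2 * Nh)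
    {k : ℕ} (hk : 1 ≤ k) {l : ZMod k} (hl : IsUnit l) (d : ℕ) :
    ∑ n ∈ (dyadic N).filter (fun n : ℕ => (n : ZMod k) = l ∧ n.Coprime d), (g * h) n =
      ∑ u ∈ (Icc 1 ⌊2 * N⌋₊).filter (fun u : ℕ => u.Coprime (d * k)), g u *
        ∑ v ∈ (Icc 1 ⌊2 * Nh⌋₊).filter (fun v : ℕ => ((u * v : ℕ) : ZMod k) = l ∧ v.Coprime d), h v := by
  haveI : NeZero k := ⟨by omega⟩
  set X := ⌊2 * N⌋₊ with hX
  set c : ℕ → ℝ := fun n => if (n : ZMod k) = l ∧ n.Coprime d then 1 else 0 with hc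
  -- Step a: extend the range from `dyadic N` to `[1, X]`
  have hβ0 : ∀ n : ℕ, (g * h) n ≠ 0 → n ∈ dyadic N := by
    intro n hn
    rw [ArithmeticFunction.mul_apply] at hn
    obtain ⟨x, hx, hx0⟩ := Finset.exists_ne_zero_of_sum_ne_zero hn
    have hg : g x.1 ≠ 0 := left_ne_zero_of_mul hx0
    have hh : h x.2 ≠ 0 := right_ne_zero_of_mul hx0
    have := hprod x.1 x.2 hg hh
    rwa [(Nat.mem_divisorsAntidiagonal.1 hx).1] at this
  have h1 : ∑ n ∈ (dyadic N).filter (fun n : ℕ => (n : ZMod k) = l ∧ n.Coprime d), (g * h) n =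
      ∑ n ∈ Icc 1 X, c n * (g * h) n := by
    rw [Finset.sum_filter]
    have : ∑ n ∈ dyadic N, (if (n : ZMod k) = l ∧ n.Coprime d then (g * h) n else 0) =
        ∑ n ∈ dyadic N, c n * (g * h) n := by
      refine Finset.sum_congr rfl fun n _ => ?_
      simp only [hc]; split_ifs <;> simp
    rw [this]
    refine sum_eq_sum_of_support fun n hn => ?_
    have hn' : (g * h) n ≠ 0 := right_ne_zero_of_mul hn
    exact ⟨fun hmem => dyadic_subset_Icc hN hmem, fun _ => hβ0 n hn'⟩
  rw [h1, sum_Icc_mul_dirichlet_eq]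
  -- Step b: restrict the `u`-sum to `(u, dk) = 1` and rewrite the inner sums
  rw [Finset.sum_filter]
  refine Finset.sum_congr rfl fun u hu => ?_
  have hu1 : 1 ≤ u := (Finset.mem_Icc.1 hu).1
  -- the inner sum over `v ≤ X/u` equals the one over `v ≤ 2Nh` (both contain the support when `g u ≠ 0`)
  by_cases hgu : g u = 0
  · simp [hgu]
  have hinner : ∑ v ∈ Icc 1 (X / u), h v * c (u * v) =
      ∑ v ∈ (Icc 1 ⌊2 * Nh⌋₊).filter (fun v : ℕ => ((u * v : ℕ) : ZMod k) = l ∧ v.Coprime d),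
        (if u.Coprime (d * k) then h v else 0) := by
    rw [Finset.sum_filter]
    have hrange : ∑ v ∈ Icc 1 (X / u), h v * c (u * v) = ∑ v ∈ Icc 1 ⌊2 * Nh⌋₊, h v * c (u * v) := by
      refine sum_eq_sum_of_support fun v hv => ?_
      have hhv : h v ≠ 0 := left_ne_zero_of_mul hv
      have hmem := hprod u v hgu hhv
      rw [mem_dyadic hN] at hmem
      have hv1 : 1 ≤ v := Nat.one_le_iff_ne_zero.2 fun h0 => by subst h0; simp at hhv
      constructor
      · intro _
        exact Finset.mem_Icc.2 ⟨hv1, Nat.le_floor (hhsupp v hhv)⟩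
      · intro _
        refine Finset.mem_Icc.2 ⟨hv1, ?_⟩
        rw [Nat.le_div_iff_mul_le (by omega), mul_comm]
        rw [hX]
        exact Nat.le_floor (by exact_mod_cast hmem.2)
    rw [hrange]
    refine Finset.sum_congr rfl fun v _ => ?_
    simp only [hc]
    by_cases hcop : u.Coprime (d * k)
    · rw [if_pos hcop]
      have hud : u.Coprime d := Nat.Coprime.coprime_mul_right_right hcop
      have hiff : (u * v).Coprime d ↔ v.Coprime d :=
        ⟨fun h1 => Nat.Coprime.coprime_mul_left h1, fun h1 => Nat.Coprime.mul_left hud h1⟩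
      by_cases hP : ((u * v : ℕ) : ZMod k) = l ∧ v.Coprime d
      · rw [if_pos hP, if_pos ⟨hP.1, hiff.2 hP.2⟩, mul_one]
      · rw [if_neg hP, if_neg (fun h1 => hP ⟨h1.1, hiff.1 h1.2⟩), mul_zero]
    · rw [if_neg hcop]
      -- `(u, dk) > 1`: the conditions on `uv` cannot hold
      have hfalse : ¬ (((u * v : ℕ) : ZMod k) = l ∧ (u * v).Coprime d) := by
        rintro ⟨h1, h2⟩
        apply hcop
        refine Nat.Coprime.mul_right (Nat.Coprime.coprime_mul_right h2) ?_
        -- `u` is a unit mod `k`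
        have hu : IsUnit (u : ZMod k) := by
          push_cast at h1
          rw [← h1] at hl
          exact isUnit_of_mul_isUnit_left hl
        exact (ZMod.isUnit_iff_coprime u k).1 hu
      rw [if_neg hfalse, mul_zero]
      split_ifs <;> simp
  rw [hinner]
  by_cases hcop : u.Coprime (d * k)
  · rw [if_pos hcop]
    congr 1
    refine Finset.sum_congr rfl fun v _ => ?_
    rw [if_pos hcop]
  · rw [if_neg hcop]
    symm
    convert (mul_zero (g u)).symm using 2
    exact Finset.sum_eq_zero fun v _ => by rw [if_neg hcop]

/-- **Opening `g ⋆ h` with a coprimality condition only** (the main-term side):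
`∑_{n∼N, (n,dk)=1} (g⋆h)(n) = ∑_{u ≤ 2N, (u,dk)=1} g(u) ∑_{v ≤ 2Nh, (v,dk)=1} h(v)`.
[cite: BombieriFriedlanderIwaniecActa1986, §15 p. 246] -/
theorem bilinear_sum_coprime_eq {g h : ArithmeticFunction ℝ} {N Nh : ℝ} (hN : 0 ≤ N)
    (hprod : ∀ u v : ℕ, g u ≠ 0 → h v ≠ 0 → u * v ∈ dyadic N)
    (hhsupp : ∀ v : ℕ, h v ≠ 0 → (v : ℝ) ≤ 2 * Nh) (q : ℕ) :
    ∑ n ∈ (dyadic N).filter (fun n : ℕ => n.Coprime q), (g * h) n =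
      ∑ u ∈ (Icc 1 ⌊2 * N⌋₊).filter (fun u : ℕ => u.Coprime q), g u *
        ∑ v ∈ (Icc 1 ⌊2 * Nh⌋₊).filter (fun v : ℕ => v.Coprime q), h v := by
  set X := ⌊2 * N⌋₊ with hX
  set c : ℕ → ℝ := fun n => if n.Coprime q then 1 else 0 with hc
  have hβ0 : ∀ n : ℕ, (g * h) n ≠ 0 → n ∈ dyadic N := by
    intro n hn
    rw [ArithmeticFunction.mul_apply] at hn
    obtain ⟨x, hx, hx0⟩ := Finset.exists_ne_zero_of_sum_ne_zero hn
    have := hprod x.1 x.2 (left_ne_zero_of_mul hx0) (right_ne_zero_of_mul hx0)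
    rwa [(Nat.mem_divisorsAntidiagonal.1 hx).1] at this
  have h1 : ∑ n ∈ (dyadic N).filter (fun n : ℕ => n.Coprime q), (g * h) n =
      ∑ n ∈ Icc 1 X, c n * (g * h) n := by
    rw [Finset.sum_filter]
    have : ∑ n ∈ dyadic N, (if n.Coprime q then (g * h) n else 0) = ∑ n ∈ dyadic N, c n * (g * h) n := by
      refine Finset.sum_congr rfl fun n _ => ?_
      simp only [hc]; split_ifs <;> simp
    rw [this]
    refine sum_eq_sum_of_support fun n hn => ?_
    exact ⟨fun hmem => dyadic_subset_Icc hN hmem, fun _ => hβ0 n (right_ne_zero_of_mul hn)⟩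
  rw [h1, sum_Icc_mul_dirichlet_eq, Finset.sum_filter]
  refine Finset.sum_congr rfl fun u hu => ?_
  have hu1 : 1 ≤ u := (Finset.mem_Icc.1 hu).1
  by_cases hgu : g u = 0
  · simp [hgu]
  have hrange : ∑ v ∈ Icc 1 (X / u), h v * c (u * v) = ∑ v ∈ Icc 1 ⌊2 * Nh⌋₊, h v * c (u * v) := by
    refine sum_eq_sum_of_support fun v hv => ?_
    have hhv : h v ≠ 0 := left_ne_zero_of_mul hv
    have hmem := hprod u v hgu hhv
    rw [mem_dyadic hN] at hmem
    have hv1 : 1 ≤ v := Nat.one_le_iff_ne_zero.2 fun h0 => by subst h0; simp at hhv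
    constructor
    · intro _; exact Finset.mem_Icc.2 ⟨hv1, Nat.le_floor (hhsupp v hhv)⟩
    · intro _
      refine Finset.mem_Icc.2 ⟨hv1, ?_⟩
      rw [Nat.le_div_iff_mul_le (by omega), mul_comm, hX]
      exact Nat.le_floor (by exact_mod_cast hmem.2)
  rw [hrange]
  by_cases hcop : u.Coprime q
  · rw [if_pos hcop, Finset.sum_filter]
    congr 1
    refine Finset.sum_congr rfl fun v _ => ?_
    simp only [hc]
    have hiff : (u * v).Coprime q ↔ v.Coprime q :=
      ⟨fun h1 => Nat.Coprime.coprime_mul_left h1, fun h1 => Nat.Coprime.mul_left hcop h1⟩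
    by_cases hv : v.Coprime q
    · rw [if_pos (hiff.2 hv), if_pos hv, mul_one]
    · rw [if_neg (fun h1 => hv (hiff.1 h1)), if_neg hv, mul_zero]
  · rw [if_neg hcop]
    convert (mul_zero (g u)) using 2
    refine Finset.sum_eq_zero fun v _ => ?_
    simp only [hc]
    rw [if_neg (fun h1 => hcop (Nat.Coprime.coprime_mul_right h1)), mul_zero]

/-- **`(A₂)` is stable under convolution with an arbitrary factor** (the exact identity): under the
support hypotheses of `bilinear_sum_filter_eq`, for `k ≥ 1`, `l` reduced and any `d`,
`Δ(g⋆h; l (k), d) = ∑_{u ≤ 2N, (u,dk)=1} g(u) · Δ(h; l ū (k), d)` where for `u` coprime to `k` we write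
the inner class as `{v : uv ≡ l}`. [cite: BombieriFriedlanderIwaniecActa1986, §15 p. 246] -/
theorem disc_conv_eq {g h : ArithmeticFunction ℝ} {N Nh : ℝ} (hN : 0 ≤ N)
    (hprod : ∀ u v : ℕ, g u ≠ 0 → h v ≠ 0 → u * v ∈ dyadic N)
    (hhsupp : ∀ v : ℕ, h v ≠ 0 → (v : ℝ) ≤ 2 * Nh)
    {k : ℕ} (hk : 1 ≤ k) {l : ZMod k} (hl : IsUnit l) (d : ℕ) :
    (∑ n ∈ (dyadic N).filter (fun n : ℕ => (n : ZMod k) = l ∧ n.Coprime d), (g * h) n) -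
        (∑ n ∈ (dyadic N).filter (fun n : ℕ => n.Coprime (d * k)), (g * h) n) / (Nat.totient k : ℝ) =
      ∑ u ∈ (Icc 1 ⌊2 * N⌋₊).filter (fun u : ℕ => u.Coprime (d * k)), g u *
        ((∑ v ∈ (Icc 1 ⌊2 * Nh⌋₊).filter (fun v : ℕ => ((u * v : ℕ) : ZMod k) = l ∧ v.Coprime d), h v) -
          (∑ v ∈ (Icc 1 ⌊2 * Nh⌋₊).filter (fun v : ℕ => v.Coprime (d * k)), h v) / (Nat.totient k : ℝ)) := by
  rw [bilinear_sum_filter_eq hN hprod hhsupp hk hl d, bilinear_sum_coprime_eq hN hprod hhsupp (d * k),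
    Finset.sum_div, ← Finset.sum_sub_distrib]
  refine Finset.sum_congr rfl fun u _ => ?_
  ring

/-! ### Absolute bounds for the discrepancy of `β = g ⋆ h` in the three ranges of the modulus -/

/-- `∑_{n∼N} |β_n| ≤ ‖β‖ (2N+1)^{1/2}` (Cauchy–Schwarz). [folklore] -/
theorem sum_abs_le_sqrt_l2Sq {N : ℝ} (hN : 0 ≤ N) (β : ℕ → ℝ) :
    ∑ n ∈ dyadic N, |β n| ≤ Real.sqrt (l2Sq N β) * Real.sqrt (2 * N + 1) := by
  have hcs := Finset.sum_mul_sq_le_sq_mul_sq (dyadic N) (fun n => |β n|) (fun _ => (1 : ℝ))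
  simp only [mul_one, one_pow, Finset.sum_const, nsmul_eq_mul, sq_abs] at hcs
  have hcard := card_dyadic_le hN
  have h0 : 0 ≤ ∑ n ∈ dyadic N, |β n| := Finset.sum_nonneg fun _ _ => abs_nonneg _
  have hl2 : l2Sq N β = ∑ n ∈ dyadic N, β n ^ 2 := rfl
  rw [← Real.sqrt_mul (l2Sq_nonneg N β), hl2]
  refine Real.le_sqrt_of_sq_le ?_
  calc (∑ n ∈ dyadic N, |β n|) ^ 2 ≤ (∑ n ∈ dyadic N, β n ^ 2) * #(dyadic N) := hcs
    _ ≤ (∑ n ∈ dyadic N, β n ^ 2) * (2 * N + 1) :=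
        mul_le_mul_of_nonneg_left hcard (Finset.sum_nonneg fun _ _ => sq_nonneg _)

/-- **Trivial bound**: `|Δ(β; l (k), d)| ≤ 2 ∑_{n∼N} |β_n|` for `k ≥ 1`. [folklore] -/
theorem abs_disc_le_two_sum_abs {N : ℝ} (β : ℕ → ℝ) {k : ℕ} (hk : 1 ≤ k) (l : ZMod k) (d : ℕ) :
    |(∑ n ∈ (dyadic N).filter (fun n : ℕ => (n : ZMod k) = l ∧ n.Coprime d), β n) -
        (∑ n ∈ (dyadic N).filter (fun n : ℕ => n.Coprime (d * k)), β n) / (Nat.totient k : ℝ)| ≤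
      2 * ∑ n ∈ dyadic N, |β n| := by
  have hφ1 : (1 : ℝ) ≤ Nat.totient k := by exact_mod_cast Nat.totient_pos.2 hk
  have hS : ∀ (P : ℕ → Prop) [DecidablePred P],
      |∑ n ∈ (dyadic N).filter P, β n| ≤ ∑ n ∈ dyadic N, |β n| := by
    intro P _
    refine (Finset.abs_sum_le_sum_abs _ _).trans ?_
    exact Finset.sum_le_sum_of_subset_of_nonneg (Finset.filter_subset _ _) fun _ _ _ => abs_nonneg _
  have h0 : 0 ≤ ∑ n ∈ dyadic N, |β n| := Finset.sum_nonneg fun _ _ => abs_nonneg _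
  refine (abs_sub _ _).trans ?_
  rw [abs_div, abs_of_pos (show (0 : ℝ) < (Nat.totient k : ℝ) by linarith)]
  have h2 : |∑ n ∈ (dyadic N).filter (fun n : ℕ => n.Coprime (d * k)), β n| / (Nat.totient k : ℝ) ≤
      ∑ n ∈ dyadic N, |β n| := by
    rw [div_le_iff₀ (by linarith)]
    exact (hS _).trans (le_mul_of_one_le_right h0 hφ1)
  linarith [hS (fun n : ℕ => (n : ZMod k) = l ∧ n.Coprime d)]

/-- `|g ⋆ h| ≤ τ^{c_g+1}` when `|g| ≤ τ^{c_g}`, `|h| ≤ 1`. [folklore] -/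
theorem abs_conv_le {g h : ArithmeticFunction ℝ} {cg : ℕ} (hg : ∀ u, |g u| ≤ (σ 0 u : ℝ) ^ cg)
    (hh : ∀ v, |h v| ≤ 1) (n : ℕ) : |(g * h) n| ≤ (σ 0 n : ℝ) ^ (cg + 1) := by
  have hF : ∀ u, |g u| ≤ 1 * (σ 0 u : ℝ) ^ cg := fun u => by simpa using hg u
  have hG : ∀ v, |h v| ≤ 1 * (σ 0 v : ℝ) ^ 0 := fun v => by simpa using hh v
  simpa using abs_mul_apply_le_sigma_zero_pow zero_le_one zero_le_one hF hG n

/-- **Small moduli**: `SWAbs` for `h` gives, through `disc_conv_eq`,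
`|Δ(g⋆h; l (k), d)| ≤ (∑_{u ≤ 2N} |g(u)|) · C τ(d)² Nh (log Nh)^{−A₂}` for `k ≤ (log Nh)^{A₁}`.
[cite: BombieriFriedlanderIwaniecActa1986, §15 p. 246] -/
theorem abs_disc_le_of_SWAbs {g h : ArithmeticFunction ℝ} {N Nh A₁ A₂ C : ℝ} (hN : 0 ≤ N)
    (hprod : ∀ u v : ℕ, g u ≠ 0 → h v ≠ 0 → u * v ∈ dyadic N)
    (hhsupp : ∀ v : ℕ, h v ≠ 0 → (v : ℝ) ≤ 2 * Nh)
    (hsw : SWAbs h Nh A₁ A₂ C) {k : ℕ} (hk : 1 ≤ k) (hkA : (k : ℝ) ≤ Real.log Nh ^ A₁)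
    {l : ZMod k} (hl : IsUnit l) {d : ℕ} (hd : d ≠ 0) :
    |(∑ n ∈ (dyadic N).filter (fun n : ℕ => (n : ZMod k) = l ∧ n.Coprime d), (g * h) n) -
        (∑ n ∈ (dyadic N).filter (fun n : ℕ => n.Coprime (d * k)), (g * h) n) / (Nat.totient k : ℝ)| ≤
      (∑ u ∈ Icc 1 ⌊2 * N⌋₊, |g u|) * (C * (σ 0 d : ℝ) ^ 2 * Nh / Real.log Nh ^ A₂) := by
  haveI : NeZero k := ⟨by omega⟩
  rw [disc_conv_eq hN hprod hhsupp hk hl d]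
  refine (Finset.abs_sum_le_sum_abs _ _).trans ?_
  rw [Finset.sum_filter, Finset.sum_mul]
  refine Finset.sum_le_sum fun u _ => ?_
  split_ifs with hcop
  · rw [abs_mul]
    refine mul_le_mul_of_nonneg_left ?_ (abs_nonneg _)
    -- `u` is a unit mod `k`; the inner class is `v ≡ l ū`
    have huk : u.Coprime k := Nat.Coprime.coprime_mul_left_right hcop
    obtain ⟨w, hw⟩ := (ZMod.isUnit_iff_coprime u k).2 huk
    have hfilt : ∀ v : ℕ, (((u * v : ℕ) : ZMod k) = l) ↔ ((v : ZMod k) = ↑w⁻¹ * l) := by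
      intro v
      push_cast
      rw [← hw]
      constructor
      · intro h1; rw [← h1, ← mul_assoc, Units.inv_mul, one_mul]
      · intro h1; rw [h1, ← mul_assoc, Units.mul_inv, one_mul]
    have hset : (Icc 1 ⌊2 * Nh⌋₊).filter (fun v : ℕ => ((u * v : ℕ) : ZMod k) = l ∧ v.Coprime d) =
        (Icc 1 ⌊2 * Nh⌋₊).filter (fun v : ℕ => (v : ZMod k) = ↑w⁻¹ * l ∧ v.Coprime d) :=
      Finset.filter_congr fun v _ => by rw [hfilt]
    rw [hset]
    exact hsw k hk hkA _ ((Units.isUnit _).mul hl) d hd (2 * Nh)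
  · -- the `SWAbs` bound is an upper bound for an absolute value, hence `≥ 0`
    have hb : 0 ≤ C * (σ 0 d : ℝ) ^ 2 * Nh / Real.log Nh ^ A₂ :=
      (abs_nonneg _).trans (hsw k hk hkA l hl d hd (2 * Nh))
    exact le_of_eq_of_le (by simp) (mul_nonneg (abs_nonneg _) hb)

/-- **Middle moduli (Shiu)**: if `|β| ≤ τ^{c}` on `n ∼ N`, then for `N` large, `1 ≤ k < N^{3/4}`
and a reduced class `l`,
`|Δ(β; l (k), d)| ≤ (C_S + 2 C_m) (N/φ(k)) (log 2N)^{2^{c+1}}`, where `C_S, x₀` are Shiu's constants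
for `τ^c` (`ε = θ = 1/4`) and `C_m` the constant of `∑_{n≤x} τ(n)^c ≤ C_m x (log x)^{2^{c+1}}`.
[cite: Shiu1980, Theorem 1] -/
theorem abs_disc_le_middle {c : ℕ} {CS x₀ Cm : ℝ} (hCS : 0 ≤ CS)
    (hS : ∀ x y : ℝ, x₀ ≤ x → x ^ (1 / 4 : ℝ) ≤ y → y ≤ x →
      ∀ q : ℕ, 1 ≤ q → (q : ℝ) < y ^ (1 - 1 / 4 : ℝ) → ∀ a : ℕ, a.Coprime q →
        ∑ n ∈ (Icc 1 ⌊x + y⌋₊).filter (fun n : ℕ => x < n ∧ (n : ZMod q) = (a : ZMod q)),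
            (σ 0 n : ℝ) ^ c ≤ CS * y / (Nat.totient q : ℝ) * Real.log x ^ (2 ^ c - 1))
    (hm : ∀ x : ℝ, 2 ≤ x → ∑ n ∈ Icc 1 ⌊x⌋₊, (σ 0 n : ℝ) ^ c ≤ Cm * x * Real.log x ^ (2 ^ (c + 1)))
    {β : ℕ → ℝ} {N : ℝ} (hN : max x₀ 2 ≤ N) (hβ : ∀ n, |β n| ≤ (σ 0 n : ℝ) ^ c)
    {k : ℕ} (hk : 1 ≤ k) (hkN : (k : ℝ) < N ^ (3 / 4 : ℝ)) {l : ZMod k} (hl : IsUnit l) (d : ℕ) :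
    |(∑ n ∈ (dyadic N).filter (fun n : ℕ => (n : ZMod k) = l ∧ n.Coprime d), β n) -
        (∑ n ∈ (dyadic N).filter (fun n : ℕ => n.Coprime (d * k)), β n) / (Nat.totient k : ℝ)| ≤
      (CS + 2 * Cm) * (N / (Nat.totient k : ℝ)) * Real.log (2 * N) ^ (2 ^ (c + 1)) := by
  haveI : NeZero k := ⟨by omega⟩
  have hx₀ : x₀ ≤ N := (le_max_left _ _).trans hN
  have hN2 : 2 ≤ N := (le_max_right _ _).trans hN
  have hN0 : 0 ≤ N := by linarith
  have hφ : (0 : ℝ) < Nat.totient k := by exact_mod_cast Nat.totient_pos.2 hk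
  have hφ1 : (1 : ℝ) ≤ Nat.totient k := by exact_mod_cast Nat.totient_pos.2 hk
  have hℓ1 : 1 ≤ Real.log (2 * N) := by
    rw [← Real.log_exp 1]
    refine Real.log_le_log (Real.exp_pos 1) ?_
    have := Real.exp_one_lt_d9; linarith
  have hℓN : Real.log N ≤ Real.log (2 * N) := Real.log_le_log (by linarith) (by linarith)
  have hlogN0 : 0 ≤ Real.log N := Real.log_nonneg (by linarith)
  -- the class sum via Shiu
  have hval : ((l.val : ℕ) : ZMod k) = l := ZMod.natCast_zmod_val l
  have hcop : l.val.Coprime k := ZMod.val_coe_unit_coprime hl.unit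
  have h1 : ∑ n ∈ (dyadic N).filter (fun n : ℕ => (n : ZMod k) = l ∧ n.Coprime d), |β n| ≤
      CS * N / (Nat.totient k : ℝ) * Real.log (2 * N) ^ (2 ^ (c + 1)) := by
    have hS' := hS N N hx₀ (by
        calc N ^ (1 / 4 : ℝ) ≤ N ^ (1 : ℝ) := Real.rpow_le_rpow_of_exponent_le (by linarith) (by norm_num)
          _ = N := Real.rpow_one N) le_rfl k hk (by norm_num at hkN ⊢; exact hkN) l.val hcop
    rw [hval, show N + N = 2 * N by ring] at hS'
    calc ∑ n ∈ (dyadic N).filter (fun n : ℕ => (n : ZMod k) = l ∧ n.Coprime d), |β n|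
        ≤ ∑ n ∈ (dyadic N).filter (fun n : ℕ => (n : ZMod k) = l), (σ 0 n : ℝ) ^ c := by
          refine le_trans (Finset.sum_le_sum fun n _ => hβ n) ?_
          exact Finset.sum_le_sum_of_subset_of_nonneg
            (Finset.monotone_filter_right _ fun n _ h => h.1) fun _ _ _ => by positivity
      _ = ∑ n ∈ (Icc 1 ⌊2 * N⌋₊).filter (fun n : ℕ => N < n ∧ (n : ZMod k) = l), (σ 0 n : ℝ) ^ c := by
          rw [dyadic_eq_filter_Icc hN0, Finset.filter_filter]
      _ ≤ CS * N / (Nat.totient k : ℝ) * Real.log N ^ (2 ^ c - 1) := hS'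
      _ ≤ CS * N / (Nat.totient k : ℝ) * Real.log (2 * N) ^ (2 ^ (c + 1)) := by
          refine mul_le_mul_of_nonneg_left ?_ (by positivity)
          calc Real.log N ^ (2 ^ c - 1) ≤ Real.log (2 * N) ^ (2 ^ c - 1) :=
                pow_le_pow_left₀ hlogN0 hℓN _
            _ ≤ Real.log (2 * N) ^ (2 ^ (c + 1)) :=
                pow_le_pow_right₀ hℓ1 (by rw [pow_succ]; omega)
  -- the full sum via the moment bound
  have h2 : ∑ n ∈ dyadic N, |β n| ≤ 2 * Cm * N * Real.log (2 * N) ^ (2 ^ (c + 1)) := by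
    calc ∑ n ∈ dyadic N, |β n| ≤ ∑ n ∈ dyadic N, (σ 0 n : ℝ) ^ c := Finset.sum_le_sum fun n _ => hβ n
      _ ≤ ∑ n ∈ Icc 1 ⌊2 * N⌋₊, (σ 0 n : ℝ) ^ c :=
          Finset.sum_le_sum_of_subset_of_nonneg (dyadic_subset_Icc hN0) fun _ _ _ => by positivity
      _ ≤ Cm * (2 * N) * Real.log (2 * N) ^ (2 ^ (c + 1)) := hm (2 * N) (by linarith)
      _ = 2 * Cm * N * Real.log (2 * N) ^ (2 ^ (c + 1)) := by ring
  -- combine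
  have hA : |∑ n ∈ (dyadic N).filter (fun n : ℕ => (n : ZMod k) = l ∧ n.Coprime d), β n| ≤
      CS * N / (Nat.totient k : ℝ) * Real.log (2 * N) ^ (2 ^ (c + 1)) :=
    (Finset.abs_sum_le_sum_abs _ _).trans h1
  have hB : |(∑ n ∈ (dyadic N).filter (fun n : ℕ => n.Coprime (d * k)), β n) / (Nat.totient k : ℝ)| ≤
      2 * Cm * N * Real.log (2 * N) ^ (2 ^ (c + 1)) / (Nat.totient k : ℝ) := by
    rw [abs_div, abs_of_pos hφ]
    refine div_le_div_of_nonneg_right ?_ hφ.le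
    refine (Finset.abs_sum_le_sum_abs _ _).trans (le_trans ?_ h2)
    exact Finset.sum_le_sum_of_subset_of_nonneg (Finset.filter_subset _ _) fun _ _ _ => abs_nonneg _
  calc _ ≤ CS * N / (Nat.totient k : ℝ) * Real.log (2 * N) ^ (2 ^ (c + 1)) +
        2 * Cm * N * Real.log (2 * N) ^ (2 ^ (c + 1)) / (Nat.totient k : ℝ) := (abs_sub _ _).trans (add_le_add hA hB)
    _ = (CS + 2 * Cm) * (N / (Nat.totient k : ℝ)) * Real.log (2 * N) ^ (2 ^ (c + 1)) := by
        field_simp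

/-- `#{n ∼ N : n ≡ l (mod k)} ≤ 2N/k + 1` for a reduced class `l`. [folklore] -/
theorem card_dyadic_filter_class_le {N : ℝ} (hN : 0 ≤ N) {k : ℕ} (hk : 1 ≤ k) {l : ZMod k} (hl : IsUnit l) :
    (#((dyadic N).filter fun n : ℕ => (n : ZMod k) = l) : ℝ) ≤ 2 * N / k + 1 := by
  haveI : NeZero k := ⟨by omega⟩
  have hcop : l.val.Coprime k := ZMod.val_coe_unit_coprime hl.unit
  have hda : IsCoprime (k : ℤ) ((l.val : ℕ) : ℤ) :=
    Nat.isCoprime_iff_coprime.2 hcop.symm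
  have h := card_dyadic_filter_mul_natCast_eq_le hN hk hda 1
  have hset : ((dyadic N).filter fun n : ℕ => (n : ZMod k) = l) =
      (dyadic N).filter fun m : ℕ => ((m * 1 : ℕ) : ZMod k) = (((l.val : ℕ) : ℤ) : ZMod k) := by
    refine Finset.filter_congr fun m _ => ?_
    rw [mul_one, Int.cast_natCast, ZMod.natCast_zmod_val]
  rw [hset]
  exact h

/-- **Large moduli (divisor bound)**: if `|β| ≤ M` on `n ∼ N`, `k ≥ 1`, `l` reduced, then
`|Δ(β; l (k), d)| ≤ (2N/k + 1 + (2N+1)/φ(k)) M`. [folklore] -/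
theorem abs_disc_le_large {β : ℕ → ℝ} {N Mx : ℝ} (hN : 0 ≤ N) (hMx : 0 ≤ Mx)
    (hβ : ∀ n ∈ dyadic N, |β n| ≤ Mx) {k : ℕ} (hk : 1 ≤ k) {l : ZMod k} (hl : IsUnit l) (d : ℕ) :
    |(∑ n ∈ (dyadic N).filter (fun n : ℕ => (n : ZMod k) = l ∧ n.Coprime d), β n) -
        (∑ n ∈ (dyadic N).filter (fun n : ℕ => n.Coprime (d * k)), β n) / (Nat.totient k : ℝ)| ≤
      (2 * N / k + 1 + (2 * N + 1) / (Nat.totient k : ℝ)) * Mx := by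
  have hφ : (0 : ℝ) < Nat.totient k := by exact_mod_cast Nat.totient_pos.2 hk
  have hA : |∑ n ∈ (dyadic N).filter (fun n : ℕ => (n : ZMod k) = l ∧ n.Coprime d), β n| ≤
      (2 * N / k + 1) * Mx := by
    calc |∑ n ∈ (dyadic N).filter (fun n : ℕ => (n : ZMod k) = l ∧ n.Coprime d), β n|
        ≤ ∑ n ∈ (dyadic N).filter (fun n : ℕ => (n : ZMod k) = l ∧ n.Coprime d), |β n| :=
          Finset.abs_sum_le_sum_abs _ _
      _ ≤ ∑ n ∈ (dyadic N).filter (fun n : ℕ => (n : ZMod k) = l), |β n| :=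
          Finset.sum_le_sum_of_subset_of_nonneg
            (Finset.monotone_filter_right _ fun n _ h => h.1) fun _ _ _ => abs_nonneg _
      _ ≤ ∑ n ∈ (dyadic N).filter (fun n : ℕ => (n : ZMod k) = l), Mx :=
          Finset.sum_le_sum fun n hn => hβ n (Finset.mem_filter.1 hn).1
      _ = #((dyadic N).filter fun n : ℕ => (n : ZMod k) = l) * Mx := by
          rw [Finset.sum_const, nsmul_eq_mul]
      _ ≤ (2 * N / k + 1) * Mx :=
          mul_le_mul_of_nonneg_right (card_dyadic_filter_class_le hN hk hl) hMx
  have hB : |(∑ n ∈ (dyadic N).filter (fun n : ℕ => n.Coprime (d * k)), β n) / (Nat.totient k : ℝ)| ≤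
      (2 * N + 1) / (Nat.totient k : ℝ) * Mx := by
    rw [abs_div, abs_of_pos hφ, div_mul_eq_mul_div]
    refine div_le_div_of_nonneg_right ?_ hφ.le
    calc |∑ n ∈ (dyadic N).filter (fun n : ℕ => n.Coprime (d * k)), β n|
        ≤ ∑ n ∈ (dyadic N).filter (fun n : ℕ => n.Coprime (d * k)), |β n| := Finset.abs_sum_le_sum_abs _ _
      _ ≤ ∑ n ∈ dyadic N, |β n| :=
          Finset.sum_le_sum_of_subset_of_nonneg (Finset.filter_subset _ _) fun _ _ _ => abs_nonneg _
      _ ≤ ∑ n ∈ dyadic N, Mx := Finset.sum_le_sum hβ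
      _ = #(dyadic N) * Mx := by rw [Finset.sum_const, nsmul_eq_mul]
      _ ≤ (2 * N + 1) * Mx := mul_le_mul_of_nonneg_right (card_dyadic_le hN) hMx
  calc _ ≤ (2 * N / k + 1) * Mx + (2 * N + 1) / (Nat.totient k : ℝ) * Mx :=
        (abs_sub _ _).trans (add_le_add hA hB)
    _ = (2 * N / k + 1 + (2 * N + 1) / (Nat.totient k : ℝ)) * Mx := by ring

/-! ### The main theorem: dense convolution pieces satisfy (A₂) -/

/-- Converting an absolute bound into BFI's relative form under the density hypothesis:
if `N ≤ ℓ^{c_D} ‖β‖²` (`ℓ = log 2N ≥ 1`) and `X ≤ T τ(d)² N ℓ^{−(A + c_D/2)}` with `0 ≤ T ≤ Cs`, then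
`X ≤ Cs ‖β‖ N^{1/2} τ(d)² ℓ^{−A}`. [folklore] -/
theorem relative_of_absolute {X T Cs N L cD A : ℝ} {β : ℕ → ℝ} {d : ℕ} (hT0 : 0 ≤ T) (hTC : T ≤ Cs)
    (hN : 0 < N) (hℓ : 1 ≤ Real.log (2 * N)) (hL : L = l2Sq N β)
    (hdens : N ≤ Real.log (2 * N) ^ cD * L)
    (hX : X ≤ T * (σ 0 d : ℝ) ^ 2 * N / Real.log (2 * N) ^ (A + cD / 2)) :
    X ≤ Cs * Real.sqrt L * N ^ (1 / 2 : ℝ) * (σ 0 d : ℝ) ^ 2 / Real.log (2 * N) ^ A := by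
  set ℓ := Real.log (2 * N) with hℓdef
  have hℓ0 : 0 < ℓ := by linarith
  have hL0 : 0 ≤ L := by rw [hL]; exact l2Sq_nonneg N β
  -- `√N ℓ^{-cD/2} ≤ √L`
  have h1 : Real.sqrt N / ℓ ^ (cD / 2) ≤ Real.sqrt L := by
    have hpow : ℓ ^ (cD / 2) = Real.sqrt (ℓ ^ cD) := by
      rw [Real.sqrt_eq_rpow, ← Real.rpow_mul hℓ0.le]; ring_nf
    rw [hpow, ← Real.sqrt_div' N (Real.rpow_nonneg hℓ0.le cD)]
    refine Real.sqrt_le_sqrt ?_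
    rw [div_le_iff₀ (Real.rpow_pos_of_pos hℓ0 cD)]
    linarith [mul_comm (ℓ ^ cD) L]
  refine hX.trans ?_
  have hsplit : T * (σ 0 d : ℝ) ^ 2 * N / ℓ ^ (A + cD / 2) =
      T * (Real.sqrt N / ℓ ^ (cD / 2)) * N ^ (1 / 2 : ℝ) * (σ 0 d : ℝ) ^ 2 / ℓ ^ A := by
    rw [Real.rpow_add hℓ0, ← Real.sqrt_eq_rpow]
    have hNN : N = Real.sqrt N * Real.sqrt N := (Real.mul_self_sqrt hN.le).symm
    conv_lhs => rw [hNN]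
    field_simp
  rw [hsplit]
  have hℓA : 0 < ℓ ^ A := Real.rpow_pos_of_pos hℓ0 A
  refine div_le_div_of_nonneg_right ?_ hℓA.le
  refine mul_le_mul_of_nonneg_right ?_ (by positivity)
  refine mul_le_mul_of_nonneg_right ?_ (by positivity)
  exact mul_le_mul hTC h1 (by positivity) (hT0.trans hTC)

/-- `x^{1/2} / x = x^{−1/2}` for `x > 0`. [folklore] -/
theorem rpow_half_div_self {x : ℝ} (hx : 0 < x) : x ^ (1 / 2 : ℝ) / x = x ^ (-(1 / 2 : ℝ)) := by
  rw [Real.rpow_neg hx.le, ← Real.sqrt_eq_rpow]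
  have h := Real.mul_self_sqrt hx.le
  have hs : 0 < Real.sqrt x := Real.sqrt_pos.2 hx
  field_simp
  nlinarith [h]

set_option maxHeartbeats 1600000 in
/-- **Dense convolution pieces satisfy BFI's (A₂)** (Bombieri–Friedlander–Iwaniec, §15 p. 246:
"the hypothesis (A₂) … is a consequence of the Siegel-Walfisz theorem", made quantitative).  Fix
Shiu's theorem, a family `Ch` of `SWAbs`-constants, the divisor exponent `c_g` of the cofactor, a
density exponent `c_D ≥ 0` and a scale ratio `K ≥ 1`.  There is a family `Csw : ℝ → ℝ` such that for
all `N ≥ 1`, `1 ≤ Nh ≤ 2N` with `log 2N ≤ K log Nh`, all arithmetic functions `g, h` with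
`SWAbs h Nh A₁ A₂ (Ch A₁ A₂)` for all `A₁, A₂ > 0`, `|h| ≤ 1`, `h(v) ≠ 0 ⇒ Nh < v ≤ 2Nh`, `|g| ≤ τ^{c_g}`,
`g(u)h(v) ≠ 0 ⇒ N < uv ≤ 2N`, and `β = g ⋆ h` dense (`N ≤ (log 2N)^{c_D} ‖β‖²`), the sequence `β`
satisfies `SiegelWalfiszHyp N 2 Csw β` (hypothesis (A₂) of BFI with `B = 2`).
[cite: BombieriFriedlanderIwaniecActa1986, §1 (A₂) p. 206 and §15 p. 246] -/
theorem siegelWalfiszHyp_of_dense (hShiu : Shiu1980BrunTitchmarsh) (Ch : ℝ → ℝ → ℝ) (cg : ℕ)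
    {cD K : ℝ} (hcD : 0 ≤ cD) (hK : 1 ≤ K) :
    ∃ Csw : ℝ → ℝ, ∀ N Nh : ℝ, ∀ g h : ArithmeticFunction ℝ,
      1 ≤ N → 1 ≤ Nh → Nh ≤ 2 * N → Real.log (2 * N) ≤ K * Real.log Nh →
      (∀ A₁ A₂ : ℝ, 0 < A₁ → 0 < A₂ → SWAbs h Nh A₁ A₂ (Ch A₁ A₂)) →
      (∀ v, |h v| ≤ 1) → (∀ v : ℕ, h v ≠ 0 → Nh < v ∧ (v : ℝ) ≤ 2 * Nh) →
      (∀ u, |g u| ≤ (σ 0 u : ℝ) ^ cg) →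
      (∀ u v : ℕ, g u ≠ 0 → h v ≠ 0 → u * v ∈ dyadic N) →
      N ≤ Real.log (2 * N) ^ cD * l2Sq N ⇑(g * h) →
      SiegelWalfiszHyp N 2 Csw ⇑(g * h) := by
  classical
  -- structural constants
  set cβ : ℕ := cg + 1 with hcβ
  obtain ⟨CS, x₀S, hCS0, hS⟩ := hShiu.sigma_zero_pow cβ (ε := 1 / 4) (θ := 1 / 4)
    (by norm_num) (by norm_num) (by norm_num) (by norm_num)
  obtain ⟨Cm, hCm0, hm⟩ := exists_sum_sigma_zero_pow_le_real cβ
  obtain ⟨Cg', hCg0, hg'⟩ := exists_sum_sigma_zero_pow_le_real cg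
  obtain ⟨Chalf, hChalf1, hhalf⟩ := exists_sigma_zero_le_mul_rpow (ε := (1 / 2 : ℝ)) (by norm_num)
  have hcβpos : (0 : ℝ) < cβ := by rw [hcβ]; positivity
  obtain ⟨Cδ, hCδ1, hδ⟩ := exists_sigma_zero_le_mul_rpow (ε := 1 / (16 * (cβ : ℝ))) (by positivity)
  -- exponents and constants as functions of `A`
  set cM : ℕ := 2 ^ (cβ + 1) with hcM
  set cG : ℕ := 2 ^ (cg + 1) with hcG
  set p₀ : ℝ → ℝ := fun A => A + cD / 2 with hp₀
  set A₁ : ℝ → ℝ := fun A => 2 * (p₀ A + cM) with hA₁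
  set A₂ : ℝ → ℝ := fun A => p₀ A + cG with hA₂
  set Nstar : ℝ := max (max x₀S 2) (Real.exp (K ^ 2)) with hNstar
  set ℓstar : ℝ := Real.log (2 * Nstar) with hℓstar
  set T₀ : ℝ → ℝ := fun A => 2 * Real.sqrt 3 * ℓstar ^ A with hT₀
  set T₁ : ℝ → ℝ := fun A => 6 * Cg' * (2 : ℝ) ^ cG * K ^ (A₂ A) * max (Ch (2 * A₁ A) (A₂ A)) 0 with hT₁
  set T₂ : ℝ := (CS + 2 * Cm) * Chalf with hT₂
  set T₃ : ℝ → ℝ := fun A => (3 + 3 * Chalf) * (Cδ ^ cβ * 2) * (2 * (5 / (16 * p₀ A))⁻¹ ^ (p₀ A)) with hT₃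
  have hK0 : 0 < K := by linarith
  have hNstar2 : 2 ≤ Nstar := le_trans (le_max_right _ _) (le_max_left _ _)
  have hℓstar0 : 0 < ℓstar := Real.log_pos (by linarith)
  refine ⟨fun A => T₀ A + T₁ A + T₂ + T₃ A, ?_⟩
  intro N Nh g h hN1 hNh1 hNh2 hKlog hsw hh1 hhsupp hgτ hprod hdens A hA d k hd1 hk l hl
  -- abbreviations and basic facts
  have hN0 : 0 < N := by linarith
  have hd : d ≠ 0 := by omega
  set ℓ : ℝ := Real.log (2 * N) with hℓdef
  have hℓpos : 0 < ℓ := Real.log_pos (by linarith)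
  have hp₀pos : 0 < p₀ A := by simp only [hp₀]; positivity
  have hT₀0 : 0 ≤ T₀ A := by simp only [hT₀]; positivity
  have hT₁0 : 0 ≤ T₁ A := by simp only [hT₁]; positivity
  have hT₂0 : 0 ≤ T₂ := by simp only [hT₂]; positivity
  have hT₃0 : 0 ≤ T₃ A := by simp only [hT₃]; positivity
  have hβabs : ∀ n, |(g * h) n| ≤ (σ 0 n : ℝ) ^ cβ := fun n => abs_conv_le hgτ hh1 n
  have hhsupp' : ∀ v : ℕ, h v ≠ 0 → (v : ℝ) ≤ 2 * Nh := fun v hv => (hhsupp v hv).2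
  have hφ : (0 : ℝ) < Nat.totient k := by exact_mod_cast Nat.totient_pos.2 hk
  have hτd1 : (1 : ℝ) ≤ (σ 0 d : ℝ) ^ 2 := one_le_pow₀ (by exact_mod_cast one_le_sigma_zero hd)
  haveI : NeZero k := ⟨by omega⟩
  have hlu : IsUnit ((l : ℤ) : ZMod k) := (ZMod.unitOfIsCoprime l hl.symm).isUnit
  have hL0 : 0 ≤ l2Sq N ⇑(g * h) := l2Sq_nonneg N _
  -- rewrite the `ite`-sums as filtered sums
  rw [← Finset.sum_filter, ← Finset.sum_filter, Real.rpow_two]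
  set D : ℝ := |(∑ n ∈ (dyadic N).filter (fun n : ℕ => (n : ZMod k) = ((l : ℤ) : ZMod k) ∧ n.Coprime d), (g * h) n) -
      (∑ n ∈ (dyadic N).filter (fun n : ℕ => n.Coprime (d * k)), (g * h) n) / (Nat.totient k : ℝ)| with hD
  have hD0 : 0 ≤ D := abs_nonneg _
  have hCsw : T₀ A ≤ T₀ A + T₁ A + T₂ + T₃ A ∧ T₁ A ≤ T₀ A + T₁ A + T₂ + T₃ A ∧
      T₂ ≤ T₀ A + T₁ A + T₂ + T₃ A ∧ T₃ A ≤ T₀ A + T₁ A + T₂ + T₃ A := by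
    refine ⟨by linarith, by linarith, by linarith, by linarith⟩
  show D ≤ (T₀ A + T₁ A + T₂ + T₃ A) * Real.sqrt (l2Sq N ⇑(g * h)) * N ^ (1 / 2 : ℝ) * (σ 0 d : ℝ) ^ 2 / ℓ ^ A
  -- the trivial bound, valid always
  have htriv : D ≤ 2 * Real.sqrt 3 * (Real.sqrt (l2Sq N ⇑(g * h)) * N ^ (1 / 2 : ℝ)) := by
    calc D ≤ 2 * ∑ n ∈ dyadic N, |(g * h) n| := abs_disc_le_two_sum_abs _ hk _ d
      _ ≤ 2 * (Real.sqrt (l2Sq N ⇑(g * h)) * Real.sqrt (2 * N + 1)) :=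
          mul_le_mul_of_nonneg_left (sum_abs_le_sqrt_l2Sq hN0.le _) (by norm_num)
      _ ≤ 2 * (Real.sqrt (l2Sq N ⇑(g * h)) * (Real.sqrt 3 * N ^ (1 / 2 : ℝ))) := by
          refine mul_le_mul_of_nonneg_left (mul_le_mul_of_nonneg_left ?_ (Real.sqrt_nonneg _)) (by norm_num)
          rw [← Real.sqrt_eq_rpow, ← Real.sqrt_mul (by norm_num)]
          exact Real.sqrt_le_sqrt (by linarith)
      _ = 2 * Real.sqrt 3 * (Real.sqrt (l2Sq N ⇑(g * h)) * N ^ (1 / 2 : ℝ)) := by ring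
  by_cases hsmall : N < Nstar
  · -- small `N`: trivial bound, `ℓ ≤ ℓstar`
    have hℓle : ℓ ^ A ≤ ℓstar ^ A := by
      refine Real.rpow_le_rpow hℓpos.le ?_ hA.le
      exact Real.log_le_log (by linarith) (by linarith)
    have hℓA : 0 < ℓ ^ A := Real.rpow_pos_of_pos hℓpos A
    rw [le_div_iff₀ hℓA]
    calc D * ℓ ^ A ≤ (2 * Real.sqrt 3 * (Real.sqrt (l2Sq N ⇑(g * h)) * N ^ (1 / 2 : ℝ))) * ℓstar ^ A :=
          mul_le_mul htriv hℓle hℓA.le (by positivity)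
      _ = T₀ A * Real.sqrt (l2Sq N ⇑(g * h)) * N ^ (1 / 2 : ℝ) * 1 := by simp only [hT₀]; ring
      _ ≤ (T₀ A + T₁ A + T₂ + T₃ A) * Real.sqrt (l2Sq N ⇑(g * h)) * N ^ (1 / 2 : ℝ) * (σ 0 d : ℝ) ^ 2 := by
          refine mul_le_mul ?_ hτd1 zero_le_one (by positivity)
          exact mul_le_mul_of_nonneg_right (mul_le_mul_of_nonneg_right hCsw.1 (Real.sqrt_nonneg _))
            (by positivity)
  -- large `N`
  rw [not_lt] at hsmall
  have hx₀2 : max x₀S 2 ≤ N := (le_max_left _ _).trans hsmall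
  have hN2 : 2 ≤ N := (le_max_right _ _).trans hx₀2
  have hNK : Real.exp (K ^ 2) ≤ N := (le_max_right _ _).trans hsmall
  have hℓ1 : 1 ≤ ℓ := by
    rw [← Real.log_exp 1]
    refine Real.log_le_log (Real.exp_pos 1) ?_
    have := Real.exp_one_lt_d9; linarith
  -- `ℓ ≥ K²` and `log Nh ≥ K`
  have hℓK2 : K ^ 2 ≤ ℓ := by
    rw [hℓdef, ← Real.log_exp (K ^ 2)]
    exact Real.log_le_log (Real.exp_pos _) (by linarith)
  have hlogNh : K ≤ Real.log Nh := by
    have : K * K ≤ K * Real.log Nh := by nlinarith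
    exact le_of_mul_le_mul_left this hK0
  have hlogNh0 : 0 < Real.log Nh := by linarith
  have hlogNhℓ : ℓ / K ≤ Real.log Nh := by rw [div_le_iff₀ hK0]; linarith
  -- case split on the modulus
  by_cases hk1 : (k : ℝ) ≤ ℓ ^ (A₁ A)
  · ---------------- small moduli: `SWAbs`
    have hkNh : (k : ℝ) ≤ Real.log Nh ^ (2 * A₁ A) := by
      have hA₁0 : 0 ≤ A₁ A := by simp only [hA₁]; positivity
      calc (k : ℝ) ≤ ℓ ^ (A₁ A) := hk1
        _ ≤ (K * Real.log Nh) ^ (A₁ A) := Real.rpow_le_rpow hℓpos.le hKlog hA₁0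
        _ = K ^ (A₁ A) * Real.log Nh ^ (A₁ A) := Real.mul_rpow hK0.le hlogNh0.le
        _ ≤ Real.log Nh ^ (A₁ A) * Real.log Nh ^ (A₁ A) :=
            mul_le_mul_of_nonneg_right (Real.rpow_le_rpow hK0.le hlogNh hA₁0) (by positivity)
        _ = Real.log Nh ^ (2 * A₁ A) := by rw [← Real.rpow_add hlogNh0]; ring_nf
    have hA₁pos : 0 < 2 * A₁ A := by simp only [hA₁]; positivity
    have hA₂pos : 0 < A₂ A := by simp only [hA₂]; positivity
    have hswC : SWAbs h Nh (2 * A₁ A) (A₂ A) (max (Ch (2 * A₁ A) (A₂ A)) 0) :=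
      (hsw _ _ hA₁pos hA₂pos).mono (le_max_left _ _) hNh1
    have hb := abs_disc_le_of_SWAbs hN0.le hprod hhsupp' hswC hk hkNh hlu hd
    -- `∑_{u ≤ 2N} |g u|`: the support of `g` lies below `2N/Nh`
    obtain ⟨v₀, hv₀⟩ | hnone := em (∃ v, h v ≠ 0)
    swap
    · -- `h = 0`: everything vanishes
      have hzero : ∀ n, (g * h) n = 0 := by
        intro n
        rw [ArithmeticFunction.mul_apply]
        refine Finset.sum_eq_zero fun x _ => ?_
        have : h x.2 = 0 := by
          by_contra hx; exact hnone ⟨x.2, hx⟩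
        rw [this, mul_zero]
      have : D = 0 := by
        simp only [hD, hzero, Finset.sum_const_zero, zero_div, sub_zero, abs_zero]
      rw [this]; positivity
    have hgsum : ∑ u ∈ Icc 1 ⌊2 * N⌋₊, |g u| ≤ Cg' * (2 ^ cG) * (2 * N / Nh + 2) * ℓ ^ cG := by
      set x : ℝ := 2 * N / Nh + 2 with hx
      have hx2 : 2 ≤ x := by
        have h0 : 0 ≤ 2 * N / Nh := div_nonneg (by linarith) (by linarith)
        rw [hx]; linarith
      -- restrict to the support of `g`, which lies in `[1, ⌊x⌋]`
      have hsupp : ∀ u : ℕ, g u ≠ 0 → u ≤ ⌊x⌋₊ := by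
        intro u hu
        have hmem := hprod u v₀ hu hv₀
        rw [mem_dyadic hN0.le] at hmem
        have hv₀' := (hhsupp v₀ hv₀).1
        refine Nat.le_floor ?_
        have huv : (u : ℝ) * v₀ ≤ 2 * N := by exact_mod_cast hmem.2
        have hv0 : (0 : ℝ) < v₀ := lt_of_le_of_lt (by linarith) hv₀'
        have : (u : ℝ) ≤ 2 * N / Nh := by
          rw [le_div_iff₀ (by linarith)]
          calc (u : ℝ) * Nh ≤ u * v₀ := mul_le_mul_of_nonneg_left hv₀'.le (Nat.cast_nonneg u)
            _ ≤ 2 * N := huv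
        rw [hx]; linarith
      calc ∑ u ∈ Icc 1 ⌊2 * N⌋₊, |g u| = ∑ u ∈ (Icc 1 ⌊2 * N⌋₊).filter (fun u => g u ≠ 0), |g u| := by
            rw [Finset.sum_filter]
            refine Finset.sum_congr rfl fun u _ => ?_
            by_cases hu : g u = 0 <;> simp [hu]
        _ ≤ ∑ u ∈ Icc 1 ⌊x⌋₊, |g u| := by
            refine Finset.sum_le_sum_of_subset_of_nonneg (fun u hu => ?_) fun _ _ _ => abs_nonneg _
            rw [Finset.mem_filter, Finset.mem_Icc] at hu
            exact Finset.mem_Icc.2 ⟨hu.1.1, hsupp u hu.2⟩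
        _ ≤ ∑ u ∈ Icc 1 ⌊x⌋₊, (σ 0 u : ℝ) ^ cg := Finset.sum_le_sum fun u _ => hgτ u
        _ ≤ Cg' * x * Real.log x ^ cG := hg' x hx2
        _ ≤ Cg' * x * (2 * ℓ) ^ cG := by
            refine mul_le_mul_of_nonneg_left (pow_le_pow_left₀ (Real.log_nonneg (by linarith)) ?_ _)
              (by positivity)
            -- `log x ≤ log (4N) ≤ 2 ℓ`
            have hx4 : x ≤ 4 * N := by
              simp only [hx]
              have : 2 * N / Nh ≤ 2 * N := div_le_self (by linarith) hNh1
              linarith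
            calc Real.log x ≤ Real.log (4 * N) := Real.log_le_log (by linarith) hx4
              _ = Real.log 2 + ℓ := by
                  rw [hℓdef, show (4 : ℝ) * N = 2 * (2 * N) by ring, Real.log_mul (by norm_num) (by linarith)]
              _ ≤ 2 * ℓ := by
                  have : Real.log 2 ≤ ℓ := Real.log_le_log (by norm_num) (by linarith)
                  linarith
        _ = Cg' * (2 ^ cG) * x * ℓ ^ cG := by rw [mul_pow]; ring
        _ = Cg' * (2 ^ cG) * (2 * N / Nh + 2) * ℓ ^ cG := by rw [hx]
    -- assemble the absolute bound `≤ T₁ τ² N ℓ^{-p₀}`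
    have habs : D ≤ T₁ A * (σ 0 d : ℝ) ^ 2 * N / ℓ ^ (A + cD / 2) := by
      have hCh0 : 0 ≤ max (Ch (2 * A₁ A) (A₂ A)) 0 := le_max_right _ _
      have step1 : D ≤ (Cg' * (2 ^ cG) * (2 * N / Nh + 2) * ℓ ^ cG) *
          (max (Ch (2 * A₁ A) (A₂ A)) 0 * (σ 0 d : ℝ) ^ 2 * Nh / Real.log Nh ^ (A₂ A)) :=
        hb.trans (mul_le_mul_of_nonneg_right hgsum (by positivity))
      refine step1.trans ?_
      -- `(2N/Nh + 2) Nh ≤ 6 N`, `(log Nh)^{-A₂} ≤ K^{A₂} ℓ^{-A₂}`, `ℓ^{cG - A₂} = ℓ^{-p₀}`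
      have h6 : (2 * N / Nh + 2) * Nh ≤ 6 * N := by
        rw [add_mul, div_mul_cancel₀ _ (by linarith)]; linarith
      have hlogpow : (Real.log Nh ^ (A₂ A))⁻¹ ≤ K ^ (A₂ A) * (ℓ ^ (A₂ A))⁻¹ := by
        have hA₂0 : 0 ≤ A₂ A := hA₂pos.le
        have h1 : (ℓ / K) ^ (A₂ A) ≤ Real.log Nh ^ (A₂ A) := Real.rpow_le_rpow (by positivity) hlogNhℓ hA₂0
        rw [Real.div_rpow hℓpos.le hK0.le] at h1
        have h2 : (Real.log Nh ^ (A₂ A))⁻¹ ≤ (ℓ ^ (A₂ A) / K ^ (A₂ A))⁻¹ :=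
          inv_anti₀ (by positivity) h1
        rw [inv_div] at h2
        rw [div_eq_mul_inv] at h2
        exact h2
      have hℓsplit : ℓ ^ (A + cD / 2) * ℓ ^ (cG : ℝ) = ℓ ^ (A₂ A) := by
        rw [← Real.rpow_add hℓpos]
      have hℓnat : ℓ ^ cG = ℓ ^ (cG : ℝ) := (Real.rpow_natCast ℓ cG).symm
      have hkey : ℓ ^ cG * (ℓ ^ (A₂ A))⁻¹ = (ℓ ^ (A + cD / 2))⁻¹ := by
        rw [← hℓsplit, hℓnat, mul_inv, mul_comm (ℓ ^ (A + cD / 2))⁻¹, ← mul_assoc,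
          mul_inv_cancel₀ (by positivity), one_mul]
      -- Everything as a product of nonneg factors
      rw [div_eq_mul_inv, div_eq_mul_inv]
      calc Cg' * 2 ^ cG * (2 * N / Nh + 2) * ℓ ^ cG *
            (max (Ch (2 * A₁ A) (A₂ A)) 0 * (σ 0 d : ℝ) ^ 2 * Nh * (Real.log Nh ^ A₂ A)⁻¹)
          = Cg' * 2 ^ cG * max (Ch (2 * A₁ A) (A₂ A)) 0 * (σ 0 d : ℝ) ^ 2 *
              (((2 * N / Nh + 2) * Nh) * (ℓ ^ cG * (Real.log Nh ^ A₂ A)⁻¹)) := by ring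
        _ ≤ Cg' * 2 ^ cG * max (Ch (2 * A₁ A) (A₂ A)) 0 * (σ 0 d : ℝ) ^ 2 *
              ((6 * N) * (ℓ ^ cG * (K ^ (A₂ A) * (ℓ ^ (A₂ A))⁻¹))) := by
            refine mul_le_mul_of_nonneg_left ?_ (by positivity)
            refine mul_le_mul h6 (mul_le_mul_of_nonneg_left hlogpow (by positivity)) (by positivity)
              (by positivity)
        _ = T₁ A * (σ 0 d : ℝ) ^ 2 * N * (ℓ ^ cG * (ℓ ^ (A₂ A))⁻¹) := by simp only [hT₁]; ring
        _ = T₁ A * (σ 0 d : ℝ) ^ 2 * N * (ℓ ^ (A + cD / 2))⁻¹ := by rw [hkey]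
    exact relative_of_absolute hT₁0 hCsw.2.1 hN0 hℓ1 rfl hdens habs
  by_cases hk2 : (k : ℝ) < N ^ (3 / 4 : ℝ)
  · ---------------- middle moduli: Shiu
    rw [not_le] at hk1
    have hb := abs_disc_le_middle hCS0 hS hm hx₀2 hβabs hk hk2 hlu d
    -- `1/φ(k) ≤ Chalf k^{-1/2} ≤ Chalf ℓ^{-A₁/2}`
    have hk0 : (0 : ℝ) < k := by exact_mod_cast hk
    have hφinv : (Nat.totient k : ℝ)⁻¹ ≤ Chalf * (k : ℝ) ^ (-(1 / 2 : ℝ)) := by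
      calc (Nat.totient k : ℝ)⁻¹ ≤ (σ 0 k : ℝ) / k := inv_totient_le_sigma_zero_div k
        _ ≤ Chalf * (k : ℝ) ^ (1 / 2 : ℝ) / k := div_le_div_of_nonneg_right (hhalf k) hk0.le
        _ = Chalf * (k : ℝ) ^ (-(1 / 2 : ℝ)) := by
            rw [mul_div_assoc, rpow_half_div_self hk0]
    have hkpow : (k : ℝ) ^ (-(1 / 2 : ℝ)) ≤ ℓ ^ (-(A₁ A / 2)) := by
      have h1 : ℓ ^ (A₁ A / 2) ≤ (k : ℝ) ^ (1 / 2 : ℝ) := by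
        have h0 : (ℓ ^ (A₁ A)) ^ (1 / 2 : ℝ) ≤ (k : ℝ) ^ (1 / 2 : ℝ) :=
          Real.rpow_le_rpow (by positivity) hk1.le (by norm_num)
        rwa [← Real.rpow_mul hℓpos.le, show A₁ A * (1 / 2) = A₁ A / 2 by ring] at h0
      rw [Real.rpow_neg hk0.le, Real.rpow_neg hℓpos.le]
      exact inv_anti₀ (by positivity) h1
    have habs : D ≤ T₂ * (σ 0 d : ℝ) ^ 2 * N / ℓ ^ (A + cD / 2) := by
      refine hb.trans ?_
      have hcMreal : ℓ ^ (2 ^ (cβ + 1)) = ℓ ^ (cM : ℝ) := by rw [hcM, Real.rpow_natCast]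
      rw [hcMreal]
      calc (CS + 2 * Cm) * (N / (Nat.totient k : ℝ)) * ℓ ^ (cM : ℝ)
          = (CS + 2 * Cm) * N * ℓ ^ (cM : ℝ) * (Nat.totient k : ℝ)⁻¹ := by ring
        _ ≤ (CS + 2 * Cm) * N * ℓ ^ (cM : ℝ) * (Chalf * ℓ ^ (-(A₁ A / 2))) := by
            refine mul_le_mul_of_nonneg_left (hφinv.trans ?_) (by positivity)
            exact mul_le_mul_of_nonneg_left hkpow (by linarith)
        _ = T₂ * N * (ℓ ^ (cM : ℝ) * ℓ ^ (-(A₁ A / 2))) := by simp only [hT₂]; ring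
        _ = T₂ * N / ℓ ^ (A + cD / 2) := by
            have hexp : (cM : ℝ) + -(A₁ A / 2) = -(A + cD / 2) := by simp only [hA₁, hp₀]; ring
            rw [← Real.rpow_add hℓpos, hexp, Real.rpow_neg hℓpos.le, ← div_eq_mul_inv]
        _ ≤ T₂ * (σ 0 d : ℝ) ^ 2 * N / ℓ ^ (A + cD / 2) := by
            refine div_le_div_of_nonneg_right ?_ (by positivity)
            calc T₂ * N = T₂ * 1 * N := by ring
              _ ≤ T₂ * (σ 0 d : ℝ) ^ 2 * N := by gcongr
    exact relative_of_absolute hT₂0 hCsw.2.2.1 hN0 hℓ1 rfl hdens habs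
  · ---------------- large moduli: divisor bound
    rw [not_lt] at hk2
    have hk0 : (0 : ℝ) < k := by exact_mod_cast hk
    -- pointwise bound on `n ∼ N`
    set Mx : ℝ := Cδ ^ cβ * 2 * N ^ (1 / 16 : ℝ) with hMx
    have hMx0 : 0 ≤ Mx := by positivity
    have hβMx : ∀ n ∈ dyadic N, |(g * h) n| ≤ Mx := by
      intro n hn
      have hn2 : (n : ℝ) ≤ 2 * N := ((mem_dyadic hN0.le).1 hn).2
      have hn0 : (0 : ℝ) ≤ n := Nat.cast_nonneg n
      calc |(g * h) n| ≤ (σ 0 n : ℝ) ^ cβ := hβabs n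
        _ ≤ (Cδ * (n : ℝ) ^ (1 / (16 * (cβ : ℝ)))) ^ cβ := pow_le_pow_left₀ (Nat.cast_nonneg _) (hδ n) cβ
        _ = Cδ ^ cβ * (n : ℝ) ^ (1 / 16 : ℝ) := by
            rw [mul_pow, ← Real.rpow_natCast ((n : ℝ) ^ _) cβ, ← Real.rpow_mul hn0]
            congr 2; field_simp
        _ ≤ Cδ ^ cβ * (2 * N) ^ (1 / 16 : ℝ) :=
            mul_le_mul_of_nonneg_left (Real.rpow_le_rpow hn0 hn2 (by norm_num)) (by positivity)
        _ ≤ Cδ ^ cβ * (2 * N ^ (1 / 16 : ℝ)) := by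
            refine mul_le_mul_of_nonneg_left ?_ (by positivity)
            rw [Real.mul_rpow (by norm_num) hN0.le]
            refine mul_le_mul_of_nonneg_right ?_ (by positivity)
            calc (2 : ℝ) ^ (1 / 16 : ℝ) ≤ (2 : ℝ) ^ (1 : ℝ) :=
                  Real.rpow_le_rpow_of_exponent_le (by norm_num) (by norm_num)
              _ = 2 := Real.rpow_one 2
        _ = Mx := by simp only [hMx]; ring
    have hb := abs_disc_le_large hN0.le hMx0 hβMx hk hlu d
    -- `2N/k + 1 + (2N+1)/φ(k) ≤ (3 + 3 Chalf) N^{5/8}`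
    have hN58 : (1 : ℝ) ≤ N ^ (5 / 8 : ℝ) := Real.one_le_rpow hN1 (by norm_num)
    have hcoef : 2 * N / k + 1 + (2 * N + 1) / (Nat.totient k : ℝ) ≤ (3 + 3 * Chalf) * N ^ (5 / 8 : ℝ) := by
      -- `2N/k ≤ 2 N^{1/4} ≤ 2 N^{5/8}`
      have h1 : 2 * N / k ≤ 2 * N ^ (5 / 8 : ℝ) := by
        rw [div_le_iff₀ hk0]
        have : N ≤ N ^ (5 / 8 : ℝ) * N ^ (3 / 4 : ℝ) := by
          rw [← Real.rpow_add hN0]; norm_num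
          calc N = N ^ (1 : ℝ) := (Real.rpow_one N).symm
            _ ≤ N ^ (11 / 8 : ℝ) := Real.rpow_le_rpow_of_exponent_le hN1 (by norm_num)
        nlinarith [Real.rpow_nonneg hN0.le (5/8 : ℝ)]
      -- `1/φ(k) ≤ Chalf k^{-1/2} ≤ Chalf N^{-3/8}`
      have hφinv : (Nat.totient k : ℝ)⁻¹ ≤ Chalf * N ^ (-(3 / 8 : ℝ)) := by
        calc (Nat.totient k : ℝ)⁻¹ ≤ (σ 0 k : ℝ) / k := inv_totient_le_sigma_zero_div k
          _ ≤ Chalf * (k : ℝ) ^ (1 / 2 : ℝ) / k := div_le_div_of_nonneg_right (hhalf k) hk0.le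
          _ = Chalf * (k : ℝ) ^ (-(1 / 2 : ℝ)) := by
              rw [mul_div_assoc, rpow_half_div_self hk0]
          _ ≤ Chalf * (N ^ (3 / 4 : ℝ)) ^ (-(1 / 2 : ℝ)) := by
              refine mul_le_mul_of_nonneg_left ?_ (by linarith)
              exact Real.rpow_le_rpow_of_nonpos (by positivity) hk2 (by norm_num)
          _ = Chalf * N ^ (-(3 / 8 : ℝ)) := by rw [← Real.rpow_mul hN0.le]; norm_num
      have h2 : (2 * N + 1) / (Nat.totient k : ℝ) ≤ 3 * Chalf * N ^ (5 / 8 : ℝ) := by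
        rw [div_eq_mul_inv]
        calc (2 * N + 1) * (Nat.totient k : ℝ)⁻¹ ≤ (3 * N) * (Chalf * N ^ (-(3 / 8 : ℝ))) :=
              mul_le_mul (by linarith) hφinv (by positivity) (by positivity)
          _ = 3 * Chalf * (N * N ^ (-(3 / 8 : ℝ))) := by ring
          _ = 3 * Chalf * N ^ (5 / 8 : ℝ) := by
              rw [show N * N ^ (-(3 / 8 : ℝ)) = N ^ (1 : ℝ) * N ^ (-(3 / 8 : ℝ)) by rw [Real.rpow_one],
                ← Real.rpow_add hN0]; norm_num
      calc 2 * N / k + 1 + (2 * N + 1) / (Nat.totient k : ℝ)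
          ≤ 2 * N ^ (5 / 8 : ℝ) + N ^ (5 / 8 : ℝ) + 3 * Chalf * N ^ (5 / 8 : ℝ) := by linarith
        _ = (3 + 3 * Chalf) * N ^ (5 / 8 : ℝ) := by ring
    -- `ℓ^{p₀} ≤ ε^{-p₀} (2N)^{5/16}`
    set ε : ℝ := 5 / (16 * p₀ A) with hε
    have hε0 : 0 < ε := by positivity
    have hℓp : ℓ ^ (p₀ A) ≤ ε⁻¹ ^ (p₀ A) * (2 ^ (5 / 16 : ℝ) * N ^ (5 / 16 : ℝ)) := by
      have h1 : ℓ ≤ (2 * N) ^ ε / ε := Real.log_le_rpow_div (by linarith) hε0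
      calc ℓ ^ (p₀ A) ≤ ((2 * N) ^ ε / ε) ^ (p₀ A) := Real.rpow_le_rpow hℓpos.le h1 hp₀pos.le
        _ = ε⁻¹ ^ (p₀ A) * ((2 * N) ^ ε) ^ (p₀ A) := by
            rw [div_eq_mul_inv, Real.mul_rpow (by positivity) (by positivity), mul_comm]
        _ = ε⁻¹ ^ (p₀ A) * (2 * N) ^ (5 / 16 : ℝ) := by
            rw [← Real.rpow_mul (by linarith)]
            congr 2
            simp only [hε]; field_simp
        _ = ε⁻¹ ^ (p₀ A) * (2 ^ (5 / 16 : ℝ) * N ^ (5 / 16 : ℝ)) := by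
            rw [Real.mul_rpow (by norm_num) hN0.le]
    have h2516 : (2 : ℝ) ^ (5 / 16 : ℝ) ≤ 2 := by
      calc (2 : ℝ) ^ (5 / 16 : ℝ) ≤ (2 : ℝ) ^ (1 : ℝ) := Real.rpow_le_rpow_of_exponent_le (by norm_num) (by norm_num)
        _ = 2 := Real.rpow_one 2
    have habs : D ≤ T₃ A * (σ 0 d : ℝ) ^ 2 * N / ℓ ^ (A + cD / 2) := by
      have hℓp0 : 0 < ℓ ^ (p₀ A) := Real.rpow_pos_of_pos hℓpos _
      have step1 : D ≤ (3 + 3 * Chalf) * N ^ (5 / 8 : ℝ) * Mx :=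
        hb.trans (mul_le_mul_of_nonneg_right hcoef hMx0)
      have hp₀eq : A + cD / 2 = p₀ A := by simp only [hp₀]
      rw [hp₀eq, le_div_iff₀ hℓp0]
      calc D * ℓ ^ (p₀ A) ≤ ((3 + 3 * Chalf) * N ^ (5 / 8 : ℝ) * Mx) * (ε⁻¹ ^ (p₀ A) * (2 ^ (5 / 16 : ℝ) * N ^ (5 / 16 : ℝ))) :=
            mul_le_mul step1 hℓp (by positivity) (by positivity)
        _ ≤ ((3 + 3 * Chalf) * N ^ (5 / 8 : ℝ) * Mx) * (ε⁻¹ ^ (p₀ A) * (2 * N ^ (5 / 16 : ℝ))) := by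
            gcongr
        _ = (3 + 3 * Chalf) * (Cδ ^ cβ * 2) * (2 * ε⁻¹ ^ (p₀ A)) *
              (N ^ (5 / 8 : ℝ) * N ^ (1 / 16 : ℝ) * N ^ (5 / 16 : ℝ)) := by simp only [hMx]; ring
        _ = T₃ A * N := by
            simp only [hT₃, hε]
            rw [← Real.rpow_add hN0, ← Real.rpow_add hN0]
            norm_num
        _ ≤ T₃ A * (σ 0 d : ℝ) ^ 2 * N := by
            calc T₃ A * N = T₃ A * 1 * N := by ring
              _ ≤ T₃ A * (σ 0 d : ℝ) ^ 2 * N := by gcongr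
    exact relative_of_absolute hT₃0 hCsw.2.2.2 hN0 hℓ1 rfl hdens habs

end BFI

end Literature.NumberTheory.Sieve
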